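import Summits.QuantumFields.YangMills.Theorems.BalabanUVNodesN19AnnealedGeneric

/-!
# BalabanUVNodes ∕ node N19 (NE7 bracket) — THE RELATIVE ANNEALED TWO-RUN BOUND: for two coercive quadratic actions on `ι → ℝ` with `Q_B ≤ (1+ε)Q_A`, `Q_A ≤ (1+ε)Q_B`
# the dressed log-partition functions match modulo constants with remainder `(e^{2|t|B} − 1)·ε·|ι|∕2` — the DIMENSION and nothing else

Cell `pub-ymgap`, HUMAN RULING D-0062 (Track A), R134 ACCELERATION seat `pub-ymgap-dag-n19-c` (N19 NE7, strategy s1), generation 14, module 22a-II; route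
`Summits/QuantumFields/YangMills/Theses/BalabanUVNodes.lean` rev 21 (K3⁵ `SpineGivenEndpointR13SepCoP` = stmt-QuantumFields-20296, `--supports … --as helper`); venue R424
(namespace `Summit.QuantumFields.YangMills.BalabanUVNodes.N19AnnealedRelative`).  ADDITIVE — imports this seat's module 22a-I `…N19AnnealedGeneric` (generic-index
Feynman–Hellmann `hasDerivAt_integral_exp_neg_path`, equipartition `integral_quadForm_mul_exp_neg`, integrability, `dressedZ_pos`) and through it p516244's L¹ re-tilt
`abs_ratio_sub_ratio_le` and p515255's `exp_mul_mem`; THEOREMS ONLY (0 `def`), modifies nothing.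

WHAT.  p516244 §5 (`abs_log_sub_log_sub_le_of_actionBound`, `ι = Tor M`) pays the action difference through a `|φ|²`-majorant: `ϑ·E|φ|² ≤ ϑ·|Tor M|∕(2γ)`.  Here the
hypothesis is RELATIVE form-closeness — `φ·Δ_Bφ ≤ (1+ε)φ·Δ_Aφ` and `φ·Δ_Aφ ≤ (1+ε)φ·Δ_Bφ` — under which the path-derivative integrand is bounded POINTWISE by `ε` times the
path action itself (`abs_sub_le_of_relClose`: `|b − a| ≤ ε·min(a,b)`), and EQUIPARTITION evaluates its mean to the dimension: remainder `(e^{2|t|B} − 1)·ε·|ι|∕2`, with no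
coercivity constant, no operator norm and no volume other than the dimension of the space the actions live on.  Relative closeness is what Schur complements inherit
(module 22b `schurForm_le_mul`), so after marginalising a local observable (22b §4) the dimension is the support of the observable (module 22c).
* [folklore] `abs_sub_le_of_relClose`, ★★ **`abs_log_sub_log_sub_le_of_relClose`**.

HONEST FRAMING.  Finite-dimensional Gaussian calculus [folklore]; consumer = King's `A = 0` scalar MODEL (module 22c) — NOT Bałaban's NE7 (NOT PRINTED; NODE O's objects).
Count-neutral; N19 NOT discharged (0∕1); counts UNMOVED (5∕27).  Everything PROVED (0 `sorry`, 0 named facts, standard axioms).  One finite four-torus programme at fixed ε;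
NOT ℝ⁴, NOT OS, NOT a mass gap, NOT Clay.
-/

noncomputable section

namespace Summit.QuantumFields.YangMills.BalabanUVNodes.N19AnnealedRelative

open MeasureTheory Set Filter Real Matrix Topology
open scoped BigOperators
open Literature.MathematicalPhysics.QuantumFieldTheory.Balaban1983to89.QGQInverse (Coercive)
open Summit.QuantumFields.YangMills.BalabanUVNodes.N19TiltPathGaussian (exp_mul_mem)
open Summit.QuantumFields.YangMills.BalabanUVNodes.N19TiltPathGaussianTwoRuns (abs_ratio_sub_ratio_le)
open Summit.QuantumFields.YangMills.BalabanUVNodes.N19AnnealedGeneric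

variable {ι : Type*} [Fintype ι] [DecidableEq ι]

/-! ## §4 The RELATIVE annealed two-run bound: form-sandwiched coercive actions -/
section Relative

/-- Two nonnegative reals within a factor `1 + ε` of each other (`ε ≥ 0`) differ by at most `ε` times the SMALLER one, hence by at most `ε` times ANY convex
combination of them: `|b − a| ≤ ε·(a + u(b − a))` for `u ∈ [0,1]`. [folklore] -/
theorem abs_sub_le_of_relClose {a b ε u : ℝ} (hε : 0 ≤ ε) (hab : b ≤ (1 + ε) * a) (hba : a ≤ (1 + ε) * b)
    (hu0 : 0 ≤ u) (hu1 : u ≤ 1) : |b - a| ≤ ε * (a + u * (b - a)) := by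
  rcases le_total a b with h | h
  · rw [abs_of_nonneg (sub_nonneg.2 h)]
    nlinarith [mul_nonneg hε (mul_nonneg hu0 (sub_nonneg.2 h))]
  · rw [abs_of_nonpos (sub_nonpos.2 h)]
    nlinarith [mul_nonneg hε (mul_nonneg (sub_nonneg.2 hu1) (sub_nonneg.2 h))]

/-- **★★ THE RELATIVE ANNEALED TWO-RUN BOUND** [folklore ∘ §1–§3 + p516244's L¹ re-tilt].  `Δ_A`, `Δ_B` real matrices on the finite index `ι`, both `γ`-coercive (`γ > 0`, used
only qualitatively: integrability, positivity, differentiability), and RELATIVELY CLOSE as forms: `φ·Δ_Bφ ≤ (1+ε)·φ·Δ_Aφ` and `φ·Δ_Aφ ≤ (1+ε)·φ·Δ_Bφ` (`ε ≥ 0`); `W` bounded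
measurable (`|W| ≤ B`); dressed partition functions `Z_X(s) = ∫ e^{−½φ·Δ_Xφ}·e^{sW(φ)} dφ` over the whole of `ι → ℝ`.  Then for every source `t`
`|log Z_B(t) − log Z_A(t) − (log Z_B(0) − log Z_A(0))| ≤ (e^{2|t|B} − 1)·ε·|ι|∕2`.
Road (p516244 §5 with ONE change): along the chord `Δ_u = Δ_A + u(Δ_B − Δ_A)` Feynman–Hellmann (§2) and the L¹ re-tilt give `|h′(u)| ≤ ½(e^{2|t|B} − 1)·E_{u,0}|φ·(Δ_B − Δ_A)φ|`;
the relative closeness bounds the integrand by `ε·φ·Δ_uφ` POINTWISE (`|b − a| ≤ ε·min(a,b)`, `abs_sub_le_of_relClose`), and EQUIPARTITION (§3) evaluates `E_{u,0}[φ·Δ_uφ] = |ι|` — the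
DIMENSION of the space the actions live on and nothing else (no `γ`, no operator norm, no volume).  For a marginalised local observable (modules 22b∕22c) `|ι| = |supp W|`. -/
theorem abs_log_sub_log_sub_le_of_relClose {ΔA ΔB : Matrix ι ι ℝ} {γ ε B : ℝ} (hγ : 0 < γ) (hε : 0 ≤ ε)
    (hcA : Coercive ΔA γ) (hcB : Coercive ΔB γ)
    (hAB : ∀ φ : ι → ℝ, φ ⬝ᵥ (ΔB *ᵥ φ) ≤ (1 + ε) * (φ ⬝ᵥ (ΔA *ᵥ φ)))
    (hBA : ∀ φ : ι → ℝ, φ ⬝ᵥ (ΔA *ᵥ φ) ≤ (1 + ε) * (φ ⬝ᵥ (ΔB *ᵥ φ)))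
    {W : (ι → ℝ) → ℝ} (hWm : Measurable W) (hWb : ∀ φ, |W φ| ≤ B) (t : ℝ) :
    |Real.log (∫ φ : ι → ℝ, Real.exp (-(φ ⬝ᵥ (ΔB *ᵥ φ) / 2)) * Real.exp (t * W φ))
        - Real.log (∫ φ : ι → ℝ, Real.exp (-(φ ⬝ᵥ (ΔA *ᵥ φ) / 2)) * Real.exp (t * W φ))
        - (Real.log (∫ φ : ι → ℝ, Real.exp (-(φ ⬝ᵥ (ΔB *ᵥ φ) / 2)) * Real.exp (0 * W φ))
            - Real.log (∫ φ : ι → ℝ, Real.exp (-(φ ⬝ᵥ (ΔA *ᵥ φ) / 2)) * Real.exp (0 * W φ)))|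
      ≤ (Real.exp (2 * (|t| * B)) - 1) * ε * Fintype.card ι / 2 := by
  -- the chord and its data
  set D : Matrix ι ι ℝ := ΔB - ΔA with hD
  have hco : ∀ u ∈ Set.Icc (0 : ℝ) 1, Coercive (ΔA + u • D) γ := fun u hu => coercive_chord hcA hcB hu.1 hu.2
  have hκ : 0 ≤ ∑ x, ∑ y, |D x y| := Finset.sum_nonneg fun x _ => Finset.sum_nonneg fun y _ => abs_nonneg _
  have hq : ∀ φ : ι → ℝ, |φ ⬝ᵥ (D *ᵥ φ)| ≤ (∑ x, ∑ y, |D x y|) * (φ ⬝ᵥ φ) := abs_quadForm_le D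
  -- the RELATIVE pointwise bound along the chord
  have hrel : ∀ u ∈ Set.Icc (0 : ℝ) 1, ∀ φ : ι → ℝ, |φ ⬝ᵥ (D *ᵥ φ)| ≤ ε * (φ ⬝ᵥ ((ΔA + u • D) *ᵥ φ)) := by
    intro u hu φ
    rw [hD, dotProduct_sub_mulVec, dotProduct_add_smul_mulVec, dotProduct_sub_mulVec]
    exact abs_sub_le_of_relClose hε (hAB φ) (hBA φ) hu.1 hu.2
  have hgm : ∀ s : ℝ, Measurable fun φ : ι → ℝ => Real.exp (s * W φ) := fun s => Real.measurable_exp.comp (hWm.const_mul s)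
  have hgb : ∀ (s : ℝ) (φ : ι → ℝ), |Real.exp (s * W φ)| ≤ Real.exp (|s| * B) := fun s φ => by
    rw [Real.abs_exp]
    exact (exp_mul_mem hWb s φ).2
  -- the path partition function, its derivative numerator, positivity, derivative, continuity
  set Z : ℝ → ℝ → ℝ := fun u s => ∫ φ : ι → ℝ, Real.exp (-(φ ⬝ᵥ ((ΔA + u • D) *ᵥ φ) / 2)) * Real.exp (s * W φ) with hZ
  set N : ℝ → ℝ → ℝ := fun u s =>
    ∫ φ : ι → ℝ, -(φ ⬝ᵥ (D *ᵥ φ) / 2) * Real.exp (-(φ ⬝ᵥ ((ΔA + u • D) *ᵥ φ) / 2)) * Real.exp (s * W φ) with hN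
  have hZpos : ∀ u ∈ Set.Icc (0 : ℝ) 1, ∀ s : ℝ, 0 < Z u s := fun u hu s => dressedZ_pos hγ (hco u hu) hWm hWb s
  have hderivZ : ∀ u ∈ Set.Ioo (0 : ℝ) 1, ∀ s : ℝ, HasDerivAt (fun v => Z v s) (N u s) u := fun u hu s =>
    hasDerivAt_integral_exp_neg_path hγ hκ (Ioo_mem_nhds hu.1 hu.2) (fun v hv => hco v (Set.Ioo_subset_Icc_self hv)) hq (hgm s) (hgb s)
  have hcontZ : ∀ s : ℝ, ContinuousOn (fun v => Z v s) (Set.Icc (0 : ℝ) 1) := fun s =>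
    continuousOn_integral_exp_neg_path hγ hco (hgm s) (hgb s)
  -- the path function `h(u) = log Z_u(t) − log Z_u(0)`
  have hderiv : ∀ u ∈ Set.Ioo (0 : ℝ) 1,
      HasDerivAt (fun v => Real.log (Z v t) - Real.log (Z v 0)) (N u t / Z u t - N u 0 / Z u 0) u := fun u hu =>
    ((hderivZ u hu t).log (hZpos u (Set.Ioo_subset_Icc_self hu) t).ne').sub
      ((hderivZ u hu 0).log (hZpos u (Set.Ioo_subset_Icc_self hu) 0).ne')
  have hcont : ContinuousOn (fun v => Real.log (Z v t) - Real.log (Z v 0)) (Set.Icc (0 : ℝ) 1) :=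
    ((hcontZ t).log fun v hv => (hZpos v hv t).ne').sub ((hcontZ 0).log fun v hv => (hZpos v hv 0).ne')
  -- the DRIFT bound on the open chord
  set C : ℝ := (Real.exp (2 * (|t| * B)) - 1) * ε * Fintype.card ι / 2 with hC
  have hbound : ∀ u ∈ Set.Ioo (0 : ℝ) 1, |N u t / Z u t - N u 0 / Z u 0| ≤ C := by
    intro u hu
    have hu' : u ∈ Set.Icc (0 : ℝ) 1 := Set.Ioo_subset_Icc_self hu
    have hcu : Coercive (ΔA + u • D) γ := hco u hu'
    -- the untilted (`s = 0`) objects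
    have hZ0 : Z u 0 = ∫ φ : ι → ℝ, Real.exp (-(φ ⬝ᵥ ((ΔA + u • D) *ᵥ φ) / 2)) := by
      simp only [hZ, zero_mul, Real.exp_zero, mul_one]
    have hN0 : N u 0 = ∫ φ : ι → ℝ, -(φ ⬝ᵥ (D *ᵥ φ) / 2) * Real.exp (-(φ ⬝ᵥ ((ΔA + u • D) *ᵥ φ) / 2)) := by
      simp only [hN, zero_mul, Real.exp_zero, mul_one]
    have hZ0pos : 0 < ∫ φ : ι → ℝ, Real.exp (-(φ ⬝ᵥ ((ΔA + u • D) *ᵥ φ) / 2)) := by rw [← hZ0]; exact hZpos u hu' 0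
    -- integrability
    have hρi := integrable_exp_neg_quadForm hγ hcu
    have hρgi := integrable_dressed hγ hcu hWm hWb t
    have hfρgi := integrable_pathDeriv_integrand hγ hκ hcu hq (hgm t) (hgb t)
    have hfρi : Integrable (fun φ : ι → ℝ => -(φ ⬝ᵥ (D *ᵥ φ) / 2) * Real.exp (-(φ ⬝ᵥ ((ΔA + u • D) *ᵥ φ) / 2))) :=
      (integrable_pathDeriv_integrand hγ hκ hcu hq (g := fun _ => (1 : ℝ)) measurable_const (fun _ => le_of_eq abs_one)).congr
        (Eventually.of_forall fun φ => mul_one _)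
    -- the L¹ re-tilt
    have key := abs_ratio_sub_ratio_le (ν := (volume : Measure (ι → ℝ)))
      (ρ := fun φ => Real.exp (-(φ ⬝ᵥ ((ΔA + u • D) *ᵥ φ) / 2))) (g := fun φ => Real.exp (t * W φ))
      (f := fun φ => -(φ ⬝ᵥ (D *ᵥ φ) / 2)) (c := |t| * B)
      (fun φ => (Real.exp_pos _).le) (fun φ => exp_mul_mem hWb t φ) hρi hρgi hfρi hfρgi hZ0pos
    -- the absolute first moment by RELATIVE closeness + EQUIPARTITION: `∫ ½|φ·Dφ|ρ ≤ ½ε·∫ (φ·Δ_uφ)ρ = ½ε·|ι|·∫ρ`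
    have hκu : 0 ≤ ∑ x, ∑ y, |(ΔA + u • D) x y| := Finset.sum_nonneg fun x _ => Finset.sum_nonneg fun y _ => abs_nonneg _
    have hSρi : Integrable (fun φ : ι → ℝ => φ ⬝ᵥ ((ΔA + u • D) *ᵥ φ) * Real.exp (-(φ ⬝ᵥ ((ΔA + u • D) *ᵥ φ) / 2))) := by
      have h := integrable_pathDeriv_integrand hγ hκu hcu (abs_quadForm_le (ΔA + u • D)) (g := fun _ => (1 : ℝ))
        measurable_const (fun _ => le_of_eq abs_one)
      refine (h.const_mul (-2)).congr (Eventually.of_forall fun φ => ?_)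
      simp only
      ring
    have hI : ∫ φ : ι → ℝ, |-(φ ⬝ᵥ (D *ᵥ φ) / 2)| * Real.exp (-(φ ⬝ᵥ ((ΔA + u • D) *ᵥ φ) / 2))
        ≤ ε / 2 * (Fintype.card ι * ∫ φ : ι → ℝ, Real.exp (-(φ ⬝ᵥ ((ΔA + u • D) *ᵥ φ) / 2))) := by
      rw [← integral_quadForm_mul_exp_neg hγ hcu, ← integral_const_mul]
      refine integral_mono_of_nonneg (Eventually.of_forall fun φ => mul_nonneg (abs_nonneg _) (Real.exp_pos _).le)
        (hSρi.const_mul _) (Eventually.of_forall fun φ => ?_)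
      have hρ0 : 0 ≤ Real.exp (-(φ ⬝ᵥ ((ΔA + u • D) *ᵥ φ) / 2)) := (Real.exp_pos _).le
      simp only
      rw [abs_neg, abs_div, abs_two]
      calc |φ ⬝ᵥ (D *ᵥ φ)| / 2 * Real.exp (-(φ ⬝ᵥ ((ΔA + u • D) *ᵥ φ) / 2))
          ≤ ε * (φ ⬝ᵥ ((ΔA + u • D) *ᵥ φ)) / 2 * Real.exp (-(φ ⬝ᵥ ((ΔA + u • D) *ᵥ φ) / 2)) :=
            mul_le_mul_of_nonneg_right (div_le_div_of_nonneg_right (hrel u hu' φ) two_pos.le) hρ0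
        _ = ε / 2 * (φ ⬝ᵥ ((ΔA + u • D) *ᵥ φ) * Real.exp (-(φ ⬝ᵥ ((ΔA + u • D) *ᵥ φ) / 2))) := by ring
    have hE : 0 ≤ Real.exp (2 * (|t| * B)) - 1 := by
      have hB : 0 ≤ B := (abs_nonneg _).trans (hWb fun _ => 0)
      linarith [Real.one_le_exp (by positivity : 0 ≤ 2 * (|t| * B))]
    rw [hZ0, hN0]
    calc |(∫ φ : ι → ℝ, -(φ ⬝ᵥ (D *ᵥ φ) / 2) * Real.exp (-(φ ⬝ᵥ ((ΔA + u • D) *ᵥ φ) / 2)) * Real.exp (t * W φ)) / Z u t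
            - (∫ φ : ι → ℝ, -(φ ⬝ᵥ (D *ᵥ φ) / 2) * Real.exp (-(φ ⬝ᵥ ((ΔA + u • D) *ᵥ φ) / 2)))
              / ∫ φ : ι → ℝ, Real.exp (-(φ ⬝ᵥ ((ΔA + u • D) *ᵥ φ) / 2))|
        ≤ (Real.exp (2 * (|t| * B)) - 1) * (∫ φ : ι → ℝ, |-(φ ⬝ᵥ (D *ᵥ φ) / 2)| * Real.exp (-(φ ⬝ᵥ ((ΔA + u • D) *ᵥ φ) / 2)))
            / ∫ φ : ι → ℝ, Real.exp (-(φ ⬝ᵥ ((ΔA + u • D) *ᵥ φ) / 2)) := key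
      _ ≤ (Real.exp (2 * (|t| * B)) - 1) * (ε / 2 * (Fintype.card ι * ∫ φ : ι → ℝ, Real.exp (-(φ ⬝ᵥ ((ΔA + u • D) *ᵥ φ) / 2))))
            / ∫ φ : ι → ℝ, Real.exp (-(φ ⬝ᵥ ((ΔA + u • D) *ᵥ φ) / 2)) := by gcongr
      _ = C := by
          rw [hC]
          field_simp
  -- the mean value inequality on `[0,1]`
  have hdiffOn : DifferentiableOn ℝ (fun v => Real.log (Z v t) - Real.log (Z v 0)) (interior (Set.Icc (0 : ℝ) 1)) := by
    rw [interior_Icc]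
    exact fun u hu => (hderiv u hu).differentiableAt.differentiableWithinAt
  have hle : ∀ u ∈ interior (Set.Icc (0 : ℝ) 1), deriv (fun v => Real.log (Z v t) - Real.log (Z v 0)) u ≤ C := by
    rw [interior_Icc]
    exact fun u hu => by rw [(hderiv u hu).deriv]; exact (abs_le.1 (hbound u hu)).2
  have hge : ∀ u ∈ interior (Set.Icc (0 : ℝ) 1), -C ≤ deriv (fun v => Real.log (Z v t) - Real.log (Z v 0)) u := by
    rw [interior_Icc]
    exact fun u hu => by rw [(hderiv u hu).deriv]; exact (abs_le.1 (hbound u hu)).1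
  have h0 : (0 : ℝ) ∈ Set.Icc (0 : ℝ) 1 := ⟨le_rfl, zero_le_one⟩
  have h1 : (1 : ℝ) ∈ Set.Icc (0 : ℝ) 1 := ⟨zero_le_one, le_rfl⟩
  have hup := (convex_Icc (0 : ℝ) 1).image_sub_le_mul_sub_of_deriv_le hcont hdiffOn hle 0 h0 1 h1 zero_le_one
  have hdn := (convex_Icc (0 : ℝ) 1).mul_sub_le_image_sub_of_le_deriv hcont hdiffOn hge 0 h0 1 h1 zero_le_one
  -- the endpoints ARE the two runs
  have hZ1 : ∀ s : ℝ, Z 1 s = ∫ φ : ι → ℝ, Real.exp (-(φ ⬝ᵥ (ΔB *ᵥ φ) / 2)) * Real.exp (s * W φ) := fun s => by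
    simp only [hZ, hD, one_smul, add_sub_cancel]
  have hZ0' : ∀ s : ℝ, Z 0 s = ∫ φ : ι → ℝ, Real.exp (-(φ ⬝ᵥ (ΔA *ᵥ φ) / 2)) * Real.exp (s * W φ) := fun s => by
    simp only [hZ, zero_smul, add_zero]
  simp only [hZ1, hZ0', sub_zero, mul_one] at hup hdn
  rw [abs_le]
  constructor <;> linarith

end Relative

end Summit.QuantumFields.YangMills.BalabanUVNodes.N19AnnealedRelative

end
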